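import Summits.CriticalPhenomena.PercolationContinuityZ3.Theorems.Transplant.FKConnectivityAllQForestAdjacentFan
import Summits.CriticalPhenomena.PercolationContinuityZ3.Theorems.Transplant.FKConnectivityAllQForestHubPairDecomposition
import Summits.CriticalPhenomena.PercolationContinuityZ3.Theorems.Transplant.FKConnectivityAllQForestHubPairOneClassIdentities
import HarnessLib

/-!
# SLIDING a free pair along pinned classes preserves forest fibre counts; the CLASS-FORM TRIANGLE and DIAMOND (fan of length 2)
# cases of the square-free adjacent forest Rayleigh node

Support file (`--supports stmt-CriticalPhenomena-4575`), FK sub-lane `prim-bschramm-fk-1` (gen 26) of the post-continuity programme;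
builds on p205010 (kernel theorem, internal audit signed; external expert review pending).  No definitions, no named facts, no sorries;
standard axioms.

THE NODE (`AdjForestRayleighNoSqOn`): `bad := #(Fo ∩ {e, f ∈ ω}, Fo) ≤ good := #(Fo ∩ {e ∈ ω}, Fo ∩ {f ∈ ω})` on a fibre `(M, u₀)`
(`e = ov`, `f = oy`; first class `ω ⊇ u₀`, second class `ω ∆ M ⊇ u₀`).  A fibre is a MULTIGRAPH IN DISGUISE: the pinned pairs `u₀` lie in
both classes, so only the pinned CLASSES `[x]` (vertices joined to `x` by pinned pairs) matter, and a free pair `s(x₁, w₁)` "is" a pair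
between the classes `[x₁]` and `[w₁]`.  The lineage's literal theorems (triangle `…ForestAdjacentTriangle`, fans / locally-connected
`…ForestAdjacentFan`) ask for the LITERAL pairs `s(v, y)`, `s(o, a)`, `s(v, a)`, …; the induction architectures of gens 24–26 (pinning,
AAM ⇒ node, memo bschramm/FROM-fk-1-g25-HUB-PAIR-DECOMPOSITION.md §6c "M3") meet these configurations in CLASS form.  This file closes
the gap:
* **`fibreCount_insert_slide`** (THE SLIDE LEMMA): for pairs `g₁ = s(x₁,w₁)`, `g₂ = s(x₂,w₂) ∉ N ∪ u₀` with `x₁ ~ x₂` and `w₁ ~ w₂`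
  pinned, `#_{(N ∪ {g₁}, u₀)}(Fo ∩ P, Fo ∩ Q) = #_{(N ∪ {g₂}, u₀)}(Fo ∩ P, Fo ∩ Q)` for all events `P, Q` that depend only on pairs other
  than `g₁, g₂` — proof: split both sides by the class of the inserted pair (`fibreCount_insert_one`); on the common fibre `(N, u₀)`,
  `ω ∪ {g₁}` is a forest iff `ω ∪ {g₂}` is (`x₁ ~_ω w₁ ⟺ x₂ ~_ω w₂` through the pinned detours);
* **`adjForestNoSq_slide`**: hence `bad` and `good` are unchanged when a free pair `∉ {e, f}` slides along pinned classes, and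
  **`exists_slide_to`**: a free pair joining `[x₂]` to `[w₂]` may be assumed to BE `s(x₂, w₂)` (if `s(x₂,w₂)` is not already free);
* **`adjForestNoSq_fibre_of_classTriangle`**: a free or pinned pair joining `[v]` to `[y]` ⇒ `bad ≤ good` (class form of the triangle
  theorem);
* **`adjForestNoSq_fibre_of_classDiamond`**: free pairs joining `[o]–[a]`, `[a]–[v]`, `[a]–[y]` for a fourth class `[a]` ⇒ `bad ≤ good`
  (class form of the fan theorem with `ℓ = 2`; this is exactly the piece "M3" of the AAM ⇒ node assembly of g25's memo §6c/§6f).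
So the node holds on every fibre whose QUOTIENT multigraph has `v, y` joined by a path of length ≤ 2 inside the link of `o`.
[cite: SempleWelsh2008, Conj. 1.1 (p. 2); Thm. 4.2 (p. 11)] [cite: Linusson2011, Prop. 2.6] [cite: Grimmett2006, §1.5 (p. 13)]
-/

noncomputable section

namespace Summit.CriticalPhenomena.PercolationContinuityZ3.Theorems
namespace FK

open Set Literature.Probability.LatticeModels Literature.Probability.Percolation
open scoped Classical symmDiff

variable {V : Type*} [Fintype V]

/-! ### The slide lemma -/

section Slide

variable {N u₀ : BondConfig V} {x₁ w₁ x₂ w₂ : V}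

omit [Fintype V] in
/-- In a configuration containing the pinned pairs, `x₁ ~ w₁ ⟺ x₂ ~ w₂` when `x₁ ~ x₂` and `w₁ ~ w₂` are pinned. [folklore] -/
theorem reachable_iff_of_pinned_ends {ω : BondConfig V} (hsub : u₀ ⊆ ω) (hx : (openGraph u₀).Reachable x₁ x₂)
    (hw : (openGraph u₀).Reachable w₁ w₂) : (openGraph ω).Reachable x₁ w₁ ↔ (openGraph ω).Reachable x₂ w₂ := by
  have hx' : (openGraph ω).Reachable x₁ x₂ := hx.mono (openGraph_mono hsub)
  have hw' : (openGraph ω).Reachable w₁ w₂ := hw.mono (openGraph_mono hsub)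
  exact ⟨fun h => hx'.symm.trans (h.trans hw'), fun h => hx'.trans (h.trans hw'.symm)⟩

/-- **THE SLIDE LEMMA.**  For non-diagonal pairs `g₁ = s(x₁,w₁)`, `g₂ = s(x₂,w₂)` outside `N ∪ u₀` with `x₁ ~ x₂`, `w₁ ~ w₂` pinned, and
events `P, Q` depending only on pairs other than `g₁, g₂`:
`#_{(N ∪ {g₁}, u₀)}(Fo ∩ P, Fo ∩ Q) = #_{(N ∪ {g₂}, u₀)}(Fo ∩ P, Fo ∩ Q)`. [cite: Linusson2011, Prop. 2.6] [cite: Grimmett2006, §1.5 (p. 13)] -/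
theorem fibreCount_insert_slide (hd : Disjoint u₀ N) (hx : (openGraph u₀).Reachable x₁ x₂) (hw : (openGraph u₀).Reachable w₁ w₂)
    (h₁N : s(x₁, w₁) ∉ N) (h₁u : s(x₁, w₁) ∉ u₀) (h₂N : s(x₂, w₂) ∉ N) (h₂u : s(x₂, w₂) ∉ u₀) (hxw₁ : x₁ ≠ w₁) (hxw₂ : x₂ ≠ w₂)
    {P Q : Set (BondConfig V)}
    (hP : ∀ ω ω' : BondConfig V, (∀ p, p ≠ s(x₁, w₁) → p ≠ s(x₂, w₂) → (p ∈ ω ↔ p ∈ ω')) → (ω ∈ P ↔ ω' ∈ P))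
    (hQ : ∀ ω ω' : BondConfig V, (∀ p, p ≠ s(x₁, w₁) → p ≠ s(x₂, w₂) → (p ∈ ω ↔ p ∈ ω')) → (ω ∈ Q ↔ ω' ∈ Q)) :
    fibreCount (insert s(x₁, w₁) N) u₀ (forestEv V ∩ P) (forestEv V ∩ Q) =
      fibreCount (insert s(x₂, w₂) N) u₀ (forestEv V ∩ P) (forestEv V ∩ Q) := by
  -- two insertions agree on all pairs other than `g₁, g₂`
  have hagree : ∀ β : BondConfig V, s(x₁, w₁) ∉ β → s(x₂, w₂) ∉ β →
      ∀ p, p ≠ s(x₁, w₁) → p ≠ s(x₂, w₂) → (p ∈ insert s(x₁, w₁) β ↔ p ∈ insert s(x₂, w₂) β) := by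
    intro β _ _ p hp1 hp2
    simp only [mem_insert_iff, hp1, hp2, false_or]
  -- forest status of the two insertions agrees on configurations containing the pinned pairs
  have hforest : ∀ β : BondConfig V, u₀ ⊆ β → s(x₁, w₁) ∉ β → s(x₂, w₂) ∉ β →
      (insert s(x₁, w₁) β ∈ forestEv V ↔ insert s(x₂, w₂) β ∈ forestEv V) := by
    intro β hsub hb1 hb2
    rw [insert_mem_forestEv_iff hxw₁ hb1, insert_mem_forestEv_iff hxw₂ hb2, mem_reachEv, mem_reachEv,
      reachable_iff_of_pinned_ends hsub hx hw]
  rw [fibreCount_insert_one h₁N, fibreCount_insert_one h₂N]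
  congr 1
  · refine fibreCount_congr_fibre N u₀ fun ω hω => ?_
    have hn1 := notMem_and_notMem_symmDiff_of_fibre h₁N h₁u hω
    have hn2 := notMem_and_notMem_symmDiff_of_fibre h₂N h₂u hω
    have hsub : u₀ ⊆ ω := fun r hr => (show r ∈ ω \ N by rw [hω]; exact hr).1
    have e1 := hforest ω hsub hn1.1 hn2.1
    have e2 := hP _ _ (hagree ω hn1.1 hn2.1)
    simp only [mem_inter_iff, mem_setOf_eq]
    constructor
    · rintro ⟨⟨-, hF, hPω⟩, -, hB⟩
      exact ⟨⟨hn2.1, e1.1 hF, e2.1 hPω⟩, hn2.2, hB⟩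
    · rintro ⟨⟨-, hF, hPω⟩, -, hB⟩
      exact ⟨⟨hn1.1, e1.2 hF, e2.2 hPω⟩, hn1.2, hB⟩
  · refine fibreCount_congr_fibre N u₀ fun ω hω => ?_
    have hn1 := notMem_and_notMem_symmDiff_of_fibre h₁N h₁u hω
    have hn2 := notMem_and_notMem_symmDiff_of_fibre h₂N h₂u hω
    have hsub' : u₀ ⊆ ω ∆ N := fun r hr =>
      Set.mem_symmDiff.2 (Or.inl ⟨(show r ∈ ω \ N by rw [hω]; exact hr).1, fun hrN => hd.le_bot ⟨hr, hrN⟩⟩)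
    have e1 := hforest (ω ∆ N) hsub' hn1.2 hn2.2
    have e2 := hQ _ _ (hagree (ω ∆ N) hn1.2 hn2.2)
    simp only [mem_inter_iff, mem_setOf_eq]
    constructor
    · rintro ⟨⟨-, hA⟩, -, hF, hQω⟩
      exact ⟨⟨hn2.1, hA⟩, hn2.2, e1.1 hF, e2.1 hQω⟩
    · rintro ⟨⟨-, hA⟩, -, hF, hQω⟩
      exact ⟨⟨hn1.1, hA⟩, hn1.2, e1.2 hF, e2.2 hQω⟩

variable {o v y : V}

/-- **Sliding a free pair `∉ {e, f}` along pinned classes changes neither `bad` nor `good`.** [cite: SempleWelsh2008, Conj. 1.1 (p. 2)]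
[cite: Linusson2011, Prop. 2.6] -/
theorem adjForestNoSq_slide (hd : Disjoint u₀ N) (hx : (openGraph u₀).Reachable x₁ x₂) (hw : (openGraph u₀).Reachable w₁ w₂)
    (h₁N : s(x₁, w₁) ∉ N) (h₁u : s(x₁, w₁) ∉ u₀) (h₂N : s(x₂, w₂) ∉ N) (h₂u : s(x₂, w₂) ∉ u₀) (hxw₁ : x₁ ≠ w₁) (hxw₂ : x₂ ≠ w₂)
    (h₁e : s(x₁, w₁) ≠ s(o, v)) (h₁f : s(x₁, w₁) ≠ s(o, y)) (h₂e : s(x₂, w₂) ≠ s(o, v)) (h₂f : s(x₂, w₂) ≠ s(o, y)) :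
    fibreCount (insert s(x₁, w₁) N) u₀ (forestEv V ∩ {ω | s(o, v) ∈ ω ∧ s(o, y) ∈ ω}) (forestEv V) =
        fibreCount (insert s(x₂, w₂) N) u₀ (forestEv V ∩ {ω | s(o, v) ∈ ω ∧ s(o, y) ∈ ω}) (forestEv V) ∧
      fibreCount (insert s(x₁, w₁) N) u₀ (forestEv V ∩ {ω | s(o, v) ∈ ω}) (forestEv V ∩ {ω | s(o, y) ∈ ω}) =
        fibreCount (insert s(x₂, w₂) N) u₀ (forestEv V ∩ {ω | s(o, v) ∈ ω}) (forestEv V ∩ {ω | s(o, y) ∈ ω}) := by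
  have hEF : ∀ ω ω' : BondConfig V, (∀ p, p ≠ s(x₁, w₁) → p ≠ s(x₂, w₂) → (p ∈ ω ↔ p ∈ ω')) →
      (ω ∈ {ω : BondConfig V | s(o, v) ∈ ω ∧ s(o, y) ∈ ω} ↔ ω' ∈ {ω : BondConfig V | s(o, v) ∈ ω ∧ s(o, y) ∈ ω}) := by
    intro ω ω' h
    simp only [mem_setOf_eq, h _ h₁e.symm h₂e.symm, h _ h₁f.symm h₂f.symm]
  have hE : ∀ ω ω' : BondConfig V, (∀ p, p ≠ s(x₁, w₁) → p ≠ s(x₂, w₂) → (p ∈ ω ↔ p ∈ ω')) →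
      (ω ∈ {ω : BondConfig V | s(o, v) ∈ ω} ↔ ω' ∈ {ω : BondConfig V | s(o, v) ∈ ω}) := by
    intro ω ω' h
    simp only [mem_setOf_eq, h _ h₁e.symm h₂e.symm]
  have hF : ∀ ω ω' : BondConfig V, (∀ p, p ≠ s(x₁, w₁) → p ≠ s(x₂, w₂) → (p ∈ ω ↔ p ∈ ω')) →
      (ω ∈ {ω : BondConfig V | s(o, y) ∈ ω} ↔ ω' ∈ {ω : BondConfig V | s(o, y) ∈ ω}) := by
    intro ω ω' h
    simp only [mem_setOf_eq, h _ h₁f.symm h₂f.symm]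
  have hU : ∀ ω ω' : BondConfig V, (∀ p, p ≠ s(x₁, w₁) → p ≠ s(x₂, w₂) → (p ∈ ω ↔ p ∈ ω')) →
      (ω ∈ (univ : Set (BondConfig V)) ↔ ω' ∈ (univ : Set (BondConfig V))) := fun _ _ _ => by simp only [mem_univ]
  have h1 := fibreCount_insert_slide hd hx hw h₁N h₁u h₂N h₂u hxw₁ hxw₂ hEF hU
  have h2 := fibreCount_insert_slide hd hx hw h₁N h₁u h₂N h₂u hxw₁ hxw₂ hE hF
  simp only [inter_univ] at h1
  exact ⟨h1, h2⟩

end Slide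

/-! ### Sliding to a literal pair -/

section SlideTo

variable {M u₀ : BondConfig V} {o v y x₁ w₁ x₂ w₂ : V}

/-- **A free pair joining the classes of `x₂` and `w₂` may be assumed to be `s(x₂, w₂)` itself**: there is a fibre `(M', u₀)` containing
`s(x₂, w₂)` and all pairs of `M` other than the slid one, inside `M ∪ {s(x₂,w₂)}`, with the same `bad` and `good`.
[cite: SempleWelsh2008, Conj. 1.1 (p. 2)] [cite: Linusson2011, Prop. 2.6] -/
theorem exists_slide_to (hd : Disjoint u₀ M) (h₁M : s(x₁, w₁) ∈ M) (hx : (openGraph u₀).Reachable x₁ x₂)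
    (hw : (openGraph u₀).Reachable w₁ w₂) (hcl : ¬ (openGraph u₀).Reachable x₂ w₂)
    (h₁e : s(x₁, w₁) ≠ s(o, v)) (h₁f : s(x₁, w₁) ≠ s(o, y)) (h₂e : s(x₂, w₂) ≠ s(o, v)) (h₂f : s(x₂, w₂) ≠ s(o, y)) :
    ∃ M' : BondConfig V, Disjoint u₀ M' ∧ s(x₂, w₂) ∈ M' ∧ M \ {s(x₁, w₁)} ⊆ M' ∧ M' ⊆ insert s(x₂, w₂) M ∧
      fibreCount M' u₀ (forestEv V ∩ {ω | s(o, v) ∈ ω ∧ s(o, y) ∈ ω}) (forestEv V) =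
        fibreCount M u₀ (forestEv V ∩ {ω | s(o, v) ∈ ω ∧ s(o, y) ∈ ω}) (forestEv V) ∧
      fibreCount M' u₀ (forestEv V ∩ {ω | s(o, v) ∈ ω}) (forestEv V ∩ {ω | s(o, y) ∈ ω}) =
        fibreCount M u₀ (forestEv V ∩ {ω | s(o, v) ∈ ω}) (forestEv V ∩ {ω | s(o, y) ∈ ω}) := by
  by_cases h₂M : s(x₂, w₂) ∈ M
  · exact ⟨M, hd, h₂M, sdiff_subset, subset_insert _ _, rfl, rfl⟩
  set N := M \ {s(x₁, w₁)} with hN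
  have h₁N : s(x₁, w₁) ∉ N := fun h => h.2 rfl
  have h₂N : s(x₂, w₂) ∉ N := fun h => h₂M h.1
  have h₁u : s(x₁, w₁) ∉ u₀ := fun h => hd.le_bot ⟨h, h₁M⟩
  have h₂u : s(x₂, w₂) ∉ u₀ := fun h => hcl ((openGraph_adj u₀ x₂ w₂).2 ⟨h, fun h' => hcl (h' ▸ SimpleGraph.Reachable.refl _)⟩).reachable
  have hxw₂ : x₂ ≠ w₂ := fun h' => hcl (h' ▸ SimpleGraph.Reachable.refl _)
  have hxw₁ : x₁ ≠ w₁ := fun h' => hcl (hx.symm.trans (h' ▸ hw))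
  have hdN : Disjoint u₀ N := hd.mono_right sdiff_subset
  have hMN : M = insert s(x₁, w₁) N := by rw [hN, insert_sdiff_singleton, insert_eq_of_mem h₁M]
  obtain ⟨hb, hg⟩ := adjForestNoSq_slide (o := o) (v := v) (y := y) hdN hx hw h₁N h₁u h₂N h₂u hxw₁ hxw₂ h₁e h₁f h₂e h₂f
  refine ⟨insert s(x₂, w₂) N, Set.disjoint_insert_right.2 ⟨h₂u, hdN⟩, mem_insert _ _, subset_insert _ _,
    insert_subset_insert sdiff_subset, ?_, ?_⟩
  · rw [← hb, ← hMN]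
  · rw [← hg, ← hMN]

end SlideTo

/-! ### The class-form triangle and diamond -/

section ClassForms

variable {M u₀ : BondConfig V} {o v y : V}

/-- If `o ~ v` is PINNED then `bad ≤ good` (equality if `e` itself is pinned, `bad = 0` otherwise: `e` closes a cycle with the pinned detour).
[cite: SempleWelsh2008, Conj. 1.1 (p. 2)] [cite: Linusson2011, Prop. 2.6] -/
theorem adjForestNoSq_le_of_pinned_ov (hd : Disjoint u₀ M) (hov : (openGraph u₀).Reachable o v) :
    fibreCount M u₀ (forestEv V ∩ {ω | s(o, v) ∈ ω ∧ s(o, y) ∈ ω}) (forestEv V) ≤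
      fibreCount M u₀ (forestEv V ∩ {ω | s(o, v) ∈ ω}) (forestEv V ∩ {ω | s(o, y) ∈ ω}) := by
  by_cases heu : s(o, v) ∈ u₀
  · exact (adjForestNoSq_bad_eq_good_of_pinned hd heu).le
  rw [fibreCount_eq_zero_of_forall _ _ _ _ fun ω hω hA _ => ?_]
  · exact Nat.zero_le _
  obtain ⟨hF, he, -⟩ := hA
  by_cases hov' : o = v
  · exact hF.1 _ he (Sym2.mk_isDiag_iff.2 hov')
  have hsub : u₀ ⊆ ω \ {s(o, v)} := fun r hr =>
    ⟨(show r ∈ ω \ M by rw [hω]; exact hr).1, fun h => heu ((mem_singleton_iff.1 h) ▸ hr)⟩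
  have hback : insert s(o, v) (ω \ {s(o, v)}) = ω := by rw [insert_sdiff_singleton, insert_eq_of_mem he]
  have hF' : IsForestCfg (insert s(o, v) (ω \ {s(o, v)})) := by rw [hback]; exact hF
  exact ((isForestCfg_insert_iff hov' (fun h => h.2 rfl)).1 hF').2 (hov.mono (openGraph_mono hsub))

/-- If `o ~ y` is PINNED then `bad ≤ good`. [cite: SempleWelsh2008, Conj. 1.1 (p. 2)] [cite: Linusson2011, Prop. 2.6] -/
theorem adjForestNoSq_le_of_pinned_oy (hd : Disjoint u₀ M) (hoy : (openGraph u₀).Reachable o y) :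
    fibreCount M u₀ (forestEv V ∩ {ω | s(o, v) ∈ ω ∧ s(o, y) ∈ ω}) (forestEv V) ≤
      fibreCount M u₀ (forestEv V ∩ {ω | s(o, v) ∈ ω}) (forestEv V ∩ {ω | s(o, y) ∈ ω}) := by
  by_cases hfu : s(o, y) ∈ u₀
  · exact (adjForestNoSq_bad_eq_good_of_pinned' hd hfu).le
  rw [fibreCount_eq_zero_of_forall _ _ _ _ fun ω hω hA _ => ?_]
  · exact Nat.zero_le _
  obtain ⟨hF, -, hf⟩ := hA
  by_cases hoy' : o = y
  · exact hF.1 _ hf (Sym2.mk_isDiag_iff.2 hoy')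
  have hsub : u₀ ⊆ ω \ {s(o, y)} := fun r hr =>
    ⟨(show r ∈ ω \ M by rw [hω]; exact hr).1, fun h => hfu ((mem_singleton_iff.1 h) ▸ hr)⟩
  have hback : insert s(o, y) (ω \ {s(o, y)}) = ω := by rw [insert_sdiff_singleton, insert_eq_of_mem hf]
  have hF' : IsForestCfg (insert s(o, y) (ω \ {s(o, y)})) := by rw [hback]; exact hF
  exact ((isForestCfg_insert_iff hoy' (fun h => h.2 rfl)).1 hF').2 (hoy.mono (openGraph_mono hsub))

/-- If `v ~ y` is PINNED then `bad ≤ good` (`bad = 0` unless `f` is pinned: `e, f` and the pinned detour close a cycle).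
[cite: SempleWelsh2008, Conj. 1.1 (p. 2)] [cite: Linusson2011, Prop. 2.6] -/
theorem adjForestNoSq_le_of_pinned_vy (hd : Disjoint u₀ M) (hvy : v ≠ y) (hpin : (openGraph u₀).Reachable v y) :
    fibreCount M u₀ (forestEv V ∩ {ω | s(o, v) ∈ ω ∧ s(o, y) ∈ ω}) (forestEv V) ≤
      fibreCount M u₀ (forestEv V ∩ {ω | s(o, v) ∈ ω}) (forestEv V ∩ {ω | s(o, y) ∈ ω}) := by
  by_cases hfu : s(o, y) ∈ u₀
  · exact (adjForestNoSq_bad_eq_good_of_pinned' hd hfu).le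
  rw [fibreCount_eq_zero_of_forall _ _ _ _ fun ω hω hA _ => ?_]
  · exact Nat.zero_le _
  obtain ⟨hF, he, hf⟩ := hA
  by_cases hov : o = v
  · exact hF.1 _ he (Sym2.mk_isDiag_iff.2 hov)
  by_cases hoy : o = y
  · exact hF.1 _ hf (Sym2.mk_isDiag_iff.2 hoy)
  have hsub : u₀ ⊆ ω \ {s(o, y)} := fun r hr =>
    ⟨(show r ∈ ω \ M by rw [hω]; exact hr).1, fun h => hfu ((mem_singleton_iff.1 h) ▸ hr)⟩
  exact not_reachable_sdiff_of_two_mem hov hoy hvy hF he hf (hpin.mono (openGraph_mono hsub))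

/-- **CLASS-FORM TRIANGLE**: a free pair `s(v₁, y₁)` joining the pinned class of `v` to the pinned class of `y` gives `bad ≤ good` at
`(o; v, y)` on `(M, u₀)`. [cite: SempleWelsh2008, Conj. 1.1 (p. 2); Thm. 4.2 (p. 11)] [cite: Linusson2011, Prop. 2.6] -/
theorem adjForestNoSq_fibre_of_classTriangle (hd : Disjoint u₀ M) (hvy : v ≠ y) {v₁ y₁ : V} (hgM : s(v₁, y₁) ∈ M)
    (hv : (openGraph u₀).Reachable v v₁) (hy : (openGraph u₀).Reachable y y₁) :
    fibreCount M u₀ (forestEv V ∩ {ω | s(o, v) ∈ ω ∧ s(o, y) ∈ ω}) (forestEv V) ≤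
      fibreCount M u₀ (forestEv V ∩ {ω | s(o, v) ∈ ω}) (forestEv V ∩ {ω | s(o, y) ∈ ω}) := by
  by_cases hov : (openGraph u₀).Reachable o v
  · exact adjForestNoSq_le_of_pinned_ov hd hov
  by_cases hoy : (openGraph u₀).Reachable o y
  · exact adjForestNoSq_le_of_pinned_oy hd hoy
  by_cases hcl : (openGraph u₀).Reachable v y
  · exact adjForestNoSq_le_of_pinned_vy hd hvy hcl
  -- slide the class pair to `s(v, y)` and use the literal triangle theorem
  have h₁e : s(v₁, y₁) ≠ s(o, v) := by
    intro h'
    rcases Sym2.eq_iff.1 h' with ⟨-, h2⟩ | ⟨-, h2⟩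
    · subst h2; exact hcl hy.symm
    · subst h2; exact hoy hy.symm
  have h₁f : s(v₁, y₁) ≠ s(o, y) := by
    intro h'
    rcases Sym2.eq_iff.1 h' with ⟨h1, -⟩ | ⟨h1, -⟩
    · subst h1; exact hov hv.symm
    · subst h1; exact hcl hv
  have h₂e : s(v, y) ≠ s(o, v) := by
    intro h'
    rcases Sym2.eq_iff.1 h' with ⟨-, h2⟩ | ⟨-, h2⟩
    · exact hvy h2.symm
    · subst h2; exact hoy (SimpleGraph.Reachable.refl _)
  have h₂f : s(v, y) ≠ s(o, y) := by
    intro h'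
    rcases Sym2.eq_iff.1 h' with ⟨h1, -⟩ | ⟨h1, -⟩
    · subst h1; exact hov (SimpleGraph.Reachable.refl _)
    · exact hvy h1
  obtain ⟨M', hd', hgM', -, -, hb, hg⟩ := exists_slide_to (o := o) (v := v) (y := y) hd hgM hv.symm hy.symm hcl h₁e h₁f h₂e h₂f
  rw [← hb, ← hg]
  exact adjForestNoSq_fibre_of_triangle hd' hvy (Or.inl hgM')

omit [Fintype V] in
/-- Two pairs whose endpoints lie in different pairs of pinned classes are different. [folklore] -/
theorem sym2_ne_of_classes {p q p' q' : V} (h1 : ¬ ((openGraph u₀).Reachable p p' ∧ (openGraph u₀).Reachable q q'))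
    (h2 : ¬ ((openGraph u₀).Reachable p q' ∧ (openGraph u₀).Reachable q p')) : s(p, q) ≠ s(p', q') := by
  intro h'
  rcases Sym2.eq_iff.1 h' with ⟨rfl, rfl⟩ | ⟨rfl, rfl⟩
  · exact h1 ⟨SimpleGraph.Reachable.refl _, SimpleGraph.Reachable.refl _⟩
  · exact h2 ⟨SimpleGraph.Reachable.refl _, SimpleGraph.Reachable.refl _⟩

/-- **CLASS-FORM DIAMOND (fan of length 2 in the quotient).**  If free pairs join the pinned classes `[o]–[a]`, `[v]–[a]`, `[a]–[y]`
for a class `[a] ∉ {[o], [v], [y]}`, then `bad ≤ good` at `(o; v, y)` on `(M, u₀)`.  (Piece "M3" of the AAM ⇒ node assembly.)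
[cite: SempleWelsh2008, Conj. 1.1 (p. 2); Thm. 4.2 (p. 11)] [cite: Linusson2011, Prop. 2.6] -/
theorem adjForestNoSq_fibre_of_classDiamond (hd : Disjoint u₀ M) (hvy : v ≠ y) (heM : s(o, v) ∈ M) (hfM : s(o, y) ∈ M)
    {a o₁ a₁ v₁ a₂ a₃ y₁ : V} (hao : ¬ (openGraph u₀).Reachable a o) (hav : ¬ (openGraph u₀).Reachable a v)
    (hay : ¬ (openGraph u₀).Reachable a y)
    (hhM : s(o₁, a₁) ∈ M) (ho₁ : (openGraph u₀).Reachable o o₁) (ha₁ : (openGraph u₀).Reachable a a₁)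
    (hgvM : s(v₁, a₂) ∈ M) (hv₁ : (openGraph u₀).Reachable v v₁) (ha₂ : (openGraph u₀).Reachable a a₂)
    (hgyM : s(a₃, y₁) ∈ M) (ha₃ : (openGraph u₀).Reachable a a₃) (hy₁ : (openGraph u₀).Reachable y y₁) :
    fibreCount M u₀ (forestEv V ∩ {ω | s(o, v) ∈ ω ∧ s(o, y) ∈ ω}) (forestEv V) ≤
      fibreCount M u₀ (forestEv V ∩ {ω | s(o, v) ∈ ω}) (forestEv V ∩ {ω | s(o, y) ∈ ω}) := by
  by_cases hov : (openGraph u₀).Reachable o v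
  · exact adjForestNoSq_le_of_pinned_ov hd hov
  by_cases hoy : (openGraph u₀).Reachable o y
  · exact adjForestNoSq_le_of_pinned_oy hd hoy
  by_cases hcl : (openGraph u₀).Reachable v y
  · exact adjForestNoSq_le_of_pinned_vy hd hvy hcl
  -- the pairs involved are pairwise distinct (they join different pairs of classes)
  have h₁e : s(o₁, a₁) ≠ s(o, v) :=
    sym2_ne_of_classes (fun h => hav (ha₁.trans h.2)) (fun h => hao (ha₁.trans h.2))
  have h₁f : s(o₁, a₁) ≠ s(o, y) :=
    sym2_ne_of_classes (fun h => hay (ha₁.trans h.2)) (fun h => hao (ha₁.trans h.2))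
  have h₂e : s(o, a) ≠ s(o, v) := sym2_ne_of_classes (fun h => hav h.2) (fun h => hao h.2)
  have h₂f : s(o, a) ≠ s(o, y) := sym2_ne_of_classes (fun h => hay h.2) (fun h => hao h.2)
  have n₁ : s(v₁, a₂) ≠ s(o₁, a₁) :=
    sym2_ne_of_classes (fun h => hov ((ho₁.trans h.1.symm).trans hv₁.symm)) (fun h => hav ((ha₁.trans h.1.symm).trans hv₁.symm))
  have n₂ : s(a₃, y₁) ≠ s(o₁, a₁) :=
    sym2_ne_of_classes (fun h => hao ((ha₃.trans h.1).trans ho₁.symm)) (fun h => hoy ((ho₁.trans h.2.symm).trans hy₁.symm))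
  have k₁e : s(v₁, a₂) ≠ s(o, v) :=
    sym2_ne_of_classes (fun h => hav (ha₂.trans h.2)) (fun h => hao (ha₂.trans h.2))
  have k₁f : s(v₁, a₂) ≠ s(o, y) :=
    sym2_ne_of_classes (fun h => hay (ha₂.trans h.2)) (fun h => hao (ha₂.trans h.2))
  have k₂e : s(v, a) ≠ s(o, v) := sym2_ne_of_classes (fun h => hav h.2) (fun h => hao h.2)
  have k₂f : s(v, a) ≠ s(o, y) := sym2_ne_of_classes (fun h => hay h.2) (fun h => hao h.2)
  have n₃ : s(o, a) ≠ s(v₁, a₂) :=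
    sym2_ne_of_classes (fun h => hov (h.1.trans hv₁.symm)) (fun h => hao (ha₂.trans h.1.symm))
  have n₄ : s(a₃, y₁) ≠ s(v₁, a₂) :=
    sym2_ne_of_classes (fun h => hav ((ha₃.trans h.1).trans hv₁.symm)) (fun h => hcl ((hv₁.trans h.2.symm).trans hy₁.symm))
  have m₁e : s(a₃, y₁) ≠ s(o, v) :=
    sym2_ne_of_classes (fun h => hao (ha₃.trans h.1)) (fun h => hav (ha₃.trans h.1))
  have m₁f : s(a₃, y₁) ≠ s(o, y) :=
    sym2_ne_of_classes (fun h => hao (ha₃.trans h.1)) (fun h => hay (ha₃.trans h.1))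
  have m₂e : s(a, y) ≠ s(o, v) := sym2_ne_of_classes (fun h => hao h.1) (fun h => hav h.1)
  have m₂f : s(a, y) ≠ s(o, y) := sym2_ne_of_classes (fun h => hao h.1) (fun h => hay h.1)
  have n₅ : s(o, a) ≠ s(a₃, y₁) :=
    sym2_ne_of_classes (fun h => hao (ha₃.trans h.1.symm)) (fun h => hoy (h.1.trans hy₁.symm))
  have n₆ : s(v, a) ≠ s(a₃, y₁) :=
    sym2_ne_of_classes (fun h => hav (ha₃.trans h.1.symm)) (fun h => hcl (h.1.trans hy₁.symm))
  -- slide 1: `[o]–[a]` to `s(o, a)`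
  obtain ⟨M₁, hd₁, hoa₁, hsub₁, -, hb₁, hg₁⟩ :=
    exists_slide_to (o := o) (v := v) (y := y) hd hhM ho₁.symm ha₁.symm (fun h => hao h.symm) h₁e h₁f h₂e h₂f
  have heM₁ : s(o, v) ∈ M₁ := hsub₁ ⟨heM, fun h => h₁e (mem_singleton_iff.1 h).symm⟩
  have hfM₁ : s(o, y) ∈ M₁ := hsub₁ ⟨hfM, fun h => h₁f (mem_singleton_iff.1 h).symm⟩
  have hgvM₁ : s(v₁, a₂) ∈ M₁ := hsub₁ ⟨hgvM, fun h => n₁ (mem_singleton_iff.1 h)⟩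
  have hgyM₁ : s(a₃, y₁) ∈ M₁ := hsub₁ ⟨hgyM, fun h => n₂ (mem_singleton_iff.1 h)⟩
  -- slide 2: `[v]–[a]` to `s(v, a)`
  obtain ⟨M₂, hd₂, hva₂, hsub₂, -, hb₂, hg₂⟩ :=
    exists_slide_to (o := o) (v := v) (y := y) hd₁ hgvM₁ hv₁.symm ha₂.symm (fun h => hav h.symm) k₁e k₁f k₂e k₂f
  have heM₂ : s(o, v) ∈ M₂ := hsub₂ ⟨heM₁, fun h => k₁e (mem_singleton_iff.1 h).symm⟩
  have hfM₂ : s(o, y) ∈ M₂ := hsub₂ ⟨hfM₁, fun h => k₁f (mem_singleton_iff.1 h).symm⟩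
  have hoa₂ : s(o, a) ∈ M₂ := hsub₂ ⟨hoa₁, fun h => n₃ (mem_singleton_iff.1 h)⟩
  have hgyM₂ : s(a₃, y₁) ∈ M₂ := hsub₂ ⟨hgyM₁, fun h => n₄ (mem_singleton_iff.1 h)⟩
  -- slide 3: `[a]–[y]` to `s(a, y)`
  obtain ⟨M₃, hd₃, hay₃, hsub₃, -, hb₃, hg₃⟩ :=
    exists_slide_to (o := o) (v := v) (y := y) hd₂ hgyM₂ ha₃.symm hy₁.symm hay m₁e m₁f m₂e m₂f
  have heM₃ : s(o, v) ∈ M₃ := hsub₃ ⟨heM₂, fun h => m₁e (mem_singleton_iff.1 h).symm⟩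
  have hfM₃ : s(o, y) ∈ M₃ := hsub₃ ⟨hfM₂, fun h => m₁f (mem_singleton_iff.1 h).symm⟩
  have hoa₃ : s(o, a) ∈ M₃ := hsub₃ ⟨hoa₂, fun h => n₅ (mem_singleton_iff.1 h)⟩
  have hva₃ : s(v, a) ∈ M₃ := hsub₃ ⟨hva₂, fun h => n₆ (mem_singleton_iff.1 h)⟩
  -- the literal fan of length 2 on `(M₃, u₀)`
  have hva : v ≠ a := fun h => hav (h ▸ SimpleGraph.Reachable.refl _)
  have hya : a ≠ y := fun h => hay (h ▸ SimpleGraph.Reachable.refl _)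
  have hov' : v ≠ o := fun h => hov (h ▸ SimpleGraph.Reachable.refl _)
  have hao' : a ≠ o := fun h => hao (h ▸ SimpleGraph.Reachable.refl _)
  have hoy' : y ≠ o := fun h => hoy (h ▸ SimpleGraph.Reachable.refl _)
  set x : ℕ → V := fun i => if i = 0 then v else if i = 1 then a else y with hxdef
  have hx0 : x 0 = v := rfl
  have hx1 : x 1 = a := rfl
  have hx2 : x 2 = y := rfl
  have key := adjForestNoSq_fibre_of_fan (M := M₃) (u₀ := u₀) (o := o) (x := x) (ℓ := 2) (by norm_num)
    (by
      intro i j hi hj h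
      interval_cases i <;> interval_cases j <;> simp only [hx0, hx1, hx2] at h <;>
        first
        | rfl
        | exact absurd h hva
        | exact absurd h.symm hva
        | exact absurd h hvy
        | exact absurd h.symm hvy
        | exact absurd h hya
        | exact absurd h.symm hya)
    (by
      intro i hi
      interval_cases i
      · exact hov'
      · exact hao'
      · exact hoy')
    (by
      intro i hi
      interval_cases i
      · exact heM₃
      · exact hoa₃
      · exact hfM₃)
    (by
      intro i hi
      interval_cases i
      · exact hva₃
      · exact hay₃)
  rw [hx0, hx2] at key
  rw [← hb₁, ← hb₂, ← hb₃, ← hg₁, ← hg₂, ← hg₃]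
  exact key

end ClassForms

end FK
end Summit.CriticalPhenomena.PercolationContinuityZ3.Theorems

end
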